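import Summits.CriticalPhenomena.SAWScalingLimit.Theorems.SAWRenewalTightnessTubeLowerBoundKestenTiltRenewal
import Summits.CriticalPhenomena.SAWScalingLimit.Theorems.SAWRenewalTightnessKestenIdentity

/-!
# Crux `TubeLowerBound` (stmt-CriticalPhenomena-4730), line `subcritical-renewal-floor`: stub S1 `stub_kestenTilt`

**Exactly tilted Kesten pairs exist below `x_c`** (Madras–Slade 1993, §4.2, (4.2.11)–(4.2.15)), in the
def-free registered form: there is `m₀ > 0` (here `m₀ = 1/2`) such that for every tilt rate `0 < m ≤ m₀`
some fugacity `z ∈ [x_c/2, x_c]` makes the tilted irreducible-bridge series sum to exactly one,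
`Σ_{w irreducible bridge} z^{|w|} e^{m·span(w)} = 1` (as the `HasSum` over the length of the finite sums
over `(sawWords n).filter IsIrrBridge`, in the step-word model of `SAWWords.lean` / `SAWWordBridges.lean`).

## Proof (self-contained; no two-point function, no mass `m(z)`, no named facts)

Everything is phrased with generating functions TRUNCATED at length `≤ N` (explicit finite sums over
the self-avoiding words `W_N = (Finset.range (N + 1)).biUnion sawWords` of length `≤ N`, as in parts I–II
`…KestenTiltCuts.lean`, `…KestenTiltRenewal.lean`; no definitions), so that only suprema over `N` of
bounded monotone sequences appear.  Write `Φ_N(z, m) = Σ_{irreducible, |w| ≤ N} z^{|w|} e^{m·span(w)}`,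
`B_N(z, m)` for the same sum over all bridge words, `H_N(z, L)` for the untilted sum over HALF-SPACE words
(`0 < x(i)` for `i ≥ 1`) ending on the line `x = L`, and `χ_N(z) = Σ_{|w| ≤ N} z^{|w|}`.

1. *Tilted renewal inequality* (`gfBr_le`): if `Φ_N(z,m) ≤ Φ̄` for all `N` then
   `B_N ≤ 1 + Φ̄ B_N` (cut a non-empty bridge at its first irreducible factor,
   `StripMass.exists_irrBridge_append`; the tilted weight is multiplicative under concatenation), so
   `B_N ≤ 1/(1 - Φ̄)` when `Φ̄ < 1` — Madras–Slade (4.2.2)–(4.2.3), tilted.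
2. *Scale-`L₀` renewal* (`gfBr_le_of_gfPos_le`): cutting a bridge of span `≥ L₀` at its LAST visit
   to the line `x = L₀` (`exists_pos_append_bridge`) gives a half-space word ending on that line
   followed by a bridge, so `B_N ≤ L₀ e^{mL₀} + H_N(z, L₀) e^{mL₀} B_N` (`0 ≤ z ≤ x_c`, the spans `< L₀`
   carry mass `≤ 1` each by `StripMass.bridgeWordMass_le_one`); hence `H_N(z, L₀) e^{mL₀} ≤ 1/2` for
   all `N` forces `B_N(z, m) ≤ 2 L₀ e^{mL₀}` for all `N` (Madras–Slade (4.1.13): `m < M̄(z)`).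
3. *Half-space words are controlled by long bridges* (`gfPos_mul_exp_le`): cutting a half-space word
   ending on `x = L` at a time where `x` is maximal (`exists_bridge_prefix_of_pos`) gives a bridge of
   span `≥ L` followed by a self-avoiding word, so `H_N(z, L) e^{mL} ≤ χ_N(z) · B_N^{span ≥ L}(z, m)`;
   and `χ_N(z) ≤ C(z) < ∞` for `z < x_c` (`SAW.Zd.exists_bound_count_mul_pow`, the radius of
   convergence of the susceptibility, in tree).
4. *No jump* (`exists_gt_gfIrr_bounded`): if `Φ_N(z⋆, m) ≤ 1 - ε` for all `N` at some
   `0 < z⋆ < x_c`, then by 1 the tilted bridge series converges at `z⋆`, so its span-tails are small,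
   so by 3 `H_N(z⋆, L₀) e^{mL₀} ≤ 1/4` for a large `L₀` and all `N`; a power series with non-negative
   coefficients that is bounded at some `z₂ > z⋆` is equi-continuous in `N` at `z⋆` from the right
   (`exists_gt_forall_le`), so `H_N(z, L₀) e^{mL₀} ≤ 1/2` for all `N` at some `z > z⋆`, and by 2
   `Φ_N(z, m) ≤ B_N(z, m)` stays bounded at `z`.  (This replaces Madras–Slade's floor `a_L ≥ χ^{-2}`,
   (4.1.21)–(4.1.22), and the continuity of the mass, Prop. 4.1.1(b) / Cor. 4.1.15–16.)
5. *The tilted pair* (`stub_kestenTilt`): for `0 < m ≤ 1/2` let `z⋆ = sup S`,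
   `S = {z ∈ [x_c/2, x_c] : ∀ N, Φ_N(z, m) ≤ 1}`.  `x_c/2 ∈ S` since `e^m/2 ≤ 1` and
   `Σ_irr x_c^{|w|} ≤ 1` (`KestenIdentity.partialSum_le_one`); `S` is closed so `z⋆ ∈ S`; `x_c ∉ S` by
   Kesten's identity (`KestenIdentity.exists_partialSum_gt`: some `Φ_N(x_c, 0) > e^{-m}`, and spans are
   `≥ 1`), so `z⋆ < x_c`; if `sup_N Φ_N(z⋆, m) < 1`, step 4 and right equi-continuity of `Φ_N` would put
   a point of `S` above `z⋆`.  Hence the partial sums increase to exactly `1`: `HasSum … 1`.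

References: H. Kesten, J. Math. Phys. 4 (1963), §4; N. Madras, G. Slade, *The Self-Avoiding Walk*
(1993), §4.1 (4.1.12)–(4.1.13), §4.2 (4.2.1)–(4.2.4), (4.2.11)–(4.2.15).
-/


noncomputable section

namespace Summit.CriticalPhenomena.SAWScalingLimit.Theorems.TubeLowerBound.SubcriticalRenewalFloor

open scoped BigOperators Classical
open Literature.Probability.LatticeModels
open Literature.Probability.RandomPlanarGeometry Literature.Probability.RandomPlanarGeometry.SAW

namespace KestenTilt

open Finset Filter Topology

/-! ### Step 4: right equi-continuity and the no-jump proposition -/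

/-- **Right equi-continuity of a monotone family of non-negative power series.** Let `F N z` be
non-decreasing in `N`, continuous in `z`, with `F_{N'} - F_N` non-decreasing in `z` on `[a, b]`
(`N ≤ N'`), and bounded at `b > a` uniformly in `N`.  If `F N a ≤ A` for all `N`, then for every
`κ > 0` there is `z ∈ (a, b]` with `F N z ≤ A + κ` for all `N`. [folklore] -/
theorem exists_gt_forall_le {F : ℕ → ℝ → ℝ} {a b B A κ : ℝ} (hab : a < b)
    (hmono : ∀ ⦃N N' : ℕ⦄, N ≤ N' → ∀ ⦃z : ℝ⦄, a ≤ z → F N z ≤ F N' z)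
    (hdiff : ∀ ⦃N N' : ℕ⦄, N ≤ N' → ∀ ⦃z z' : ℝ⦄,
        a ≤ z → z ≤ z' → F N' z - F N z ≤ F N' z' - F N z')
    (hcont : ∀ N, ContinuousAt (F N) a) (hB : ∀ N, F N b ≤ B) (hA : ∀ N, F N a ≤ A) (hκ : 0 < κ) :
    ∃ z, a < z ∧ z ≤ b ∧ ∀ N, F N z ≤ A + κ := by
  have hbdd : BddAbove (Set.range fun N => F N b) := ⟨B, by rintro _ ⟨N, rfl⟩; exact hB N⟩
  set G := sSup (Set.range fun N => F N b) with hG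
  have hle : ∀ N, F N b ≤ G := fun N => le_csSup hbdd ⟨N, rfl⟩
  obtain ⟨_, ⟨N₀, rfl⟩, hN₀⟩ :=
    exists_lt_of_lt_csSup (Set.range_nonempty fun N => F N b) (show G - κ / 2 < G by linarith)
  obtain ⟨δ, hδ, hδ'⟩ := Metric.continuousAt_iff.1 (hcont N₀) (κ / 2) (by linarith)
  have hz1 : a < min (a + δ / 2) b := lt_min (by linarith) hab
  refine ⟨min (a + δ / 2) b, hz1, min_le_right _ _, fun N => ?_⟩
  set z := min (a + δ / 2) b with hz
  have hzb : z ≤ b := min_le_right _ _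
  have hdist : dist z a < δ := by
    rw [Real.dist_eq, abs_of_nonneg (by linarith)]
    have := min_le_left (a + δ / 2) b
    linarith
  have h1 := hδ' hdist
  rw [Real.dist_eq, abs_lt] at h1
  have h2 := hdiff (le_max_right N N₀) hz1.le hzb
  have h3 := hmono (le_max_left N N₀) hz1.le
  have h4 := hle (max N N₀)
  have h5 := hA N₀
  linarith

/-- `a e^{t} ≤ c` gives `a ≤ c e^{-t}`. [folklore] -/
theorem le_mul_exp_neg_of_mul_exp_le {a c t : ℝ} (h : a * Real.exp t ≤ c) : a ≤ c
    * Real.exp (-t) := by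
  have : a = a * Real.exp t * Real.exp (-t) := by
    rw [mul_assoc, ← Real.exp_add, add_neg_cancel, Real.exp_zero, mul_one]
  rw [this]
  exact mul_le_mul_of_nonneg_right h (Real.exp_nonneg _)

/-- **No jump.** If `Φ_N(z⋆, m) ≤ 1 - ε` for all `N` at some `0 < z⋆ < x_c` (`m > 0`, `ε > 0`), then
`Φ_N(z, m)` is bounded uniformly in `N` at some `z ∈ (z⋆, x_c)`: the tilted bridge series converges at
`z⋆` (step 1), so its span tails are small, so `H_N(z⋆, L₀) e^{mL₀} ≤ 1/4` for a large `L₀` (step 3),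
so `H_N(z, L₀) e^{mL₀} ≤ 1/2` slightly to the right of `z⋆` (equi-continuity), and step 2 applies at `z`.
[cite: MadrasSlade1993, §4.1, (4.1.12)–(4.1.22)] -/
theorem exists_gt_gfIrr_bounded {zs m ε : ℝ} (hzs : 0 < zs) (hzc : zs < criticalFugacity)
    (hm : 0 < m) (hε : 0 < ε) (hΦ : ∀ N,
        (∑ w ∈ ((Finset.range (N + 1)).biUnion sawWords).filter (fun w => IsIrrBridge w),
        zs ^ w.length * Real.exp (m * (xEnd w : ℝ))) ≤ 1 - ε) :
    ∃ z C : ℝ, zs < z ∧ z < criticalFugacity ∧ ∀ N,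
        (∑ w ∈ ((Finset.range (N + 1)).biUnion sawWords).filter (fun w => IsIrrBridge w),
        z ^ w.length * Real.exp (m * (xEnd w : ℝ))) ≤ C := by
  -- 1. the tilted bridge series is bounded at `zs`
  have hB : ∀ N, (∑ w ∈ ((Finset.range (N + 1)).biUnion sawWords).filter (fun w => IsBridgeW w),
      zs ^ w.length * Real.exp (m * (xEnd w : ℝ))) ≤ 1 / (1 - (1 - ε)) := fun N =>
    gfBr_le_of_lt_one hzs.le (by linarith) N (hΦ N)
  obtain ⟨Cχ, hCχ, hχ⟩ := gfAll_bounded hzs hzc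
  -- 2. small span tails
  obtain ⟨L₀, -, htail⟩ := exists_gfBrGe_le hzs.le hB (show 0 < 1 / (4 * Cχ) by positivity)
  -- 3. `H_N(zs, L₀) e^{m L₀} ≤ 1/4`
  have hH : ∀ N, (∑ w ∈ ((Finset.range (N + 1)).biUnion sawWords).filter
      (fun w => (∀ i, 1 ≤ i → i ≤ w.length → 0 < xAt w i) ∧ xEnd w = (L₀ : ℤ)), zs ^ w.length) ≤ 1 / 4
      * Real.exp (-(m * L₀)) := fun N => by
    refine le_mul_exp_neg_of_mul_exp_le ?_
    calc (∑ w ∈ ((Finset.range (N + 1)).biUnion sawWords).filter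
        (fun w => (∀ i, 1 ≤ i → i ≤ w.length → 0 < xAt w i) ∧ xEnd w = (L₀ : ℤ)), zs ^ w.length)
        * Real.exp (m * L₀) ≤
        (∑ w ∈ ((Finset.range (N + 1)).biUnion sawWords).filter
        (fun w => IsBridgeW w ∧ (L₀ : ℤ) ≤ xEnd w), zs ^ w.length * Real.exp (m * (xEnd w : ℝ)))
        * (∑ w ∈ ((Finset.range (N + 1)).biUnion sawWords), zs ^ w.length) :=
          gfPos_mul_exp_le hzs.le hm.le N L₀
      _ ≤ 1 / (4 * Cχ) * Cχ :=
          mul_le_mul (htail N) (hχ N) (gfAll_nonneg hzs.le N) (by positivity)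
      _ = 1 / 4 := by field_simp
  -- 4. equi-continuity to the right of `zs`
  set z₂ := (zs + criticalFugacity) / 2 with hz₂
  have hz₂gt : zs < z₂ := by rw [hz₂]; linarith
  have hz₂lt : z₂ < criticalFugacity := by rw [hz₂]; linarith
  obtain ⟨C₂, -, hC₂⟩ := gfAll_bounded (hzs.trans hz₂gt) hz₂lt
  obtain ⟨z, hz1, hz2, hHz⟩ := exists_gt_forall_le (F :=
      fun N z => (∑ w ∈ ((Finset.range (N + 1)).biUnion sawWords).filter
      (fun w => (∀ i, 1 ≤ i → i ≤ w.length → 0 < xAt w i) ∧ xEnd w = (L₀ : ℤ)), z ^ w.length)) (B := C₂)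
    (κ := 1 / 4 * Real.exp (-(m * L₀))) hz₂gt
    (fun N N' hN z hz => gfPos_mono_N hN (hzs.le.trans hz) _)
    (fun N N' hN z z' hz hzz' => gfPos_sub_mono hN (hzs.le.trans hz) hzz' _)
    (fun N => (continuous_gfPos N _).continuousAt)
    (fun N => (gfPos_le_gfAll (hzs.le.trans hz₂gt.le) N _).trans (hC₂ N)) hH (by positivity)
  have hz0 : 0 ≤ z := hzs.le.trans hz1.le
  have hHz' : ∀ N, (∑ w ∈ ((Finset.range (N + 1)).biUnion sawWords).filter
      (fun w => (∀ i, 1 ≤ i → i ≤ w.length → 0 < xAt w i) ∧ xEnd w = (L₀ : ℤ)), z ^ w.length) * Real.exp (m * L₀)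
      ≤ 1 / 2 := fun N => by
    have hexp : Real.exp (-(m * L₀)) * Real.exp (m * L₀) = 1 := by
      rw [← Real.exp_add, neg_add_cancel, Real.exp_zero]
    calc (∑ w ∈ ((Finset.range (N + 1)).biUnion sawWords).filter
        (fun w => (∀ i, 1 ≤ i → i ≤ w.length → 0 < xAt w i) ∧ xEnd w = (L₀ : ℤ)), z ^ w.length) * Real.exp (m * L₀)
        ≤ (1 / 4 * Real.exp (-(m * L₀)) + 1 / 4 * Real.exp (-(m * L₀))) * Real.exp (m * L₀) :=
          mul_le_mul_of_nonneg_right (hHz N) (Real.exp_nonneg _)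
      _ = (Real.exp (-(m * L₀)) * Real.exp (m * L₀)) / 2 := by ring
      _ = 1 / 2 := by rw [hexp]
  -- 5. scale-`L₀` renewal at `z`
  refine ⟨z, 2 * (L₀ * Real.exp (m * L₀)), hz1, hz2.trans_lt hz₂lt, fun N => ?_⟩
  exact (gfIrr_le_gfBr hz0 N m).trans (gfBr_le_of_gfPos_le hz0 (hz2.trans hz₂lt.le) hm.le (hHz' N))

/-! ### Step 5: the end points `x_c/2` and `x_c`, and the partial sums -/

/-- `e^{m} ≤ 2` for `m ≤ 1/2` (`e < 4`). [folklore] -/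
theorem exp_le_two {m : ℝ} (hm : m ≤ 1 / 2) : Real.exp m ≤ 2 := by
  refine (Real.exp_le_exp.2 hm).trans ?_
  have h : Real.exp (1 / 2) ^ 2 = Real.exp 1 := by
    rw [← Real.exp_nat_mul]
    norm_num
  have h1 : Real.exp 1 < 4 := Real.exp_one_lt_d9.trans (by norm_num)
  have h2 := Real.exp_pos (1 / 2 : ℝ)
  nlinarith

/-- **`Φ_N(x_c/2, m) ≤ 1`** for `0 ≤ m` with `e^m ≤ 2`: `(x_c/2)^{|w|} e^{m·span} ≤ x_c^{|w|} (e^m/2)^{|w|}`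
(`span ≤ |w|`) and `Σ_irr x_c^{|w|} ≤ 1` (`KestenIdentity.partialSum_le_one`).
[cite: MadrasSlade1993, §4.2, (4.2.4)] -/
theorem gfIrr_half_le_one {m : ℝ} (hm : 0 ≤ m) (hem : Real.exp m ≤ 2) (N : ℕ) :
    (∑ w ∈ ((Finset.range (N + 1)).biUnion sawWords).filter (fun w => IsIrrBridge w),
        (criticalFugacity / 2) ^ w.length * Real.exp (m * (xEnd w : ℝ))) ≤ 1 := by
  have hxc := StripMass.criticalFugacity_pos
  have hS : ∀ s ∈ ((Finset.range (N + 1)).biUnion sawWords).filter (fun w => IsIrrBridge w),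
      IsIrrBridge s := fun s hs =>
    (Finset.mem_filter.1 hs).2
  refine le_trans (Finset.sum_le_sum fun w _ => ?_) (KestenIdentity.partialSum_le_one _ hS)
  have h1 : Real.exp (m * (xEnd w : ℝ)) ≤ Real.exp (m * w.length) :=
    Real.exp_le_exp.2 (mul_le_mul_of_nonneg_left (by exact_mod_cast xEnd_le_length w) hm)
  have h2 : Real.exp (m * w.length) = Real.exp m ^ w.length := by
    rw [← Real.exp_nat_mul, mul_comm]
  calc (criticalFugacity / 2) ^ w.length * Real.exp (m * (xEnd w : ℝ))
      ≤ (criticalFugacity / 2) ^ w.length * Real.exp m ^ w.length :=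
        mul_le_mul_of_nonneg_left (h1.trans_eq h2) (pow_nonneg (by positivity) _)
    _ = criticalFugacity ^ w.length * (Real.exp m / 2) ^ w.length := by
        rw [← mul_pow, ← mul_pow]
        congr 1
        ring
    _ ≤ criticalFugacity ^ w.length * 1 :=
        mul_le_mul_of_nonneg_left (pow_le_one₀ (by positivity) (by linarith)) (pow_nonneg hxc.le _)
    _ = criticalFugacity ^ w.length := mul_one _

/-- **`Φ_N(x_c, m) > 1` for some `N`** (`m > 0`): by Kesten's identity some finite set of irreducible
bridges has `Σ x_c^{|s|} > e^{-m}` (`KestenIdentity.exists_partialSum_gt`), and every irreducible bridge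
has span `≥ 1`. [cite: MadrasSlade1993, §4.2, (4.2.4)] -/
theorem exists_gfIrr_criticalFugacity_gt {m : ℝ} (hm : 0 < m) :
    ∃ N, 1 < (∑ w ∈ ((Finset.range (N + 1)).biUnion sawWords).filter (fun w => IsIrrBridge w),
        criticalFugacity ^ w.length * Real.exp (m * (xEnd w : ℝ))) := by
  have hA : Real.exp (-m) < 1 := by
    rw [← Real.exp_zero]
    exact Real.exp_lt_exp.2 (by linarith)
  obtain ⟨S, hS, hgt⟩ := KestenIdentity.exists_partialSum_gt hA
  have hxc := StripMass.criticalFugacity_pos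
  refine ⟨S.sup List.length, ?_⟩
  have hsub : S ⊆ ((Finset.range ((S.sup List.length) + 1)).biUnion sawWords).filter
      (fun w => IsIrrBridge w) := fun s hs =>
    Finset.mem_filter.2 ⟨mem_Wset.2 ⟨Finset.le_sup (f := List.length) hs, (hS s hs).saw⟩, hS s hs⟩
  calc (1 : ℝ) = Real.exp (-m) * Real.exp m := by
        rw [← Real.exp_add, neg_add_cancel, Real.exp_zero]
    _ < (∑ s ∈ S, criticalFugacity ^ s.length) * Real.exp m :=
        mul_lt_mul_of_pos_right hgt (Real.exp_pos m)
    _ = ∑ s ∈ S, criticalFugacity ^ s.length * Real.exp m := Finset.sum_mul _ _ _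
    _ ≤ ∑ s ∈ S, (criticalFugacity ^ s.length * Real.exp (m * (xEnd s : ℝ))) := by
        refine Finset.sum_le_sum fun s hs => mul_le_mul_of_nonneg_left (Real.exp_le_exp.2 ?_)
          (pow_nonneg hxc.le _)
        have h1 : (1 : ℝ) ≤ (xEnd s : ℝ) := by
          exact_mod_cast StripMass.one_le_xEnd_of_ne_nil (hS s hs).bridge (hS s hs).ne_nil
        nlinarith
    _ ≤ (∑ w ∈ ((Finset.range ((S.sup List.length) + 1)).biUnion sawWords).filter
          (fun w => IsIrrBridge w), criticalFugacity ^ w.length * Real.exp (m * (xEnd w : ℝ))) :=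
        Finset.sum_le_sum_of_subset_of_nonneg hsub fun w _ _ => tiltWt_nonneg hxc.le m w

/-- The partial sums of the registered series are the `Φ_N`. [folklore] -/
theorem partialSum_eq (N : ℕ) (z m : ℝ) :
    ∑ n ∈ Finset.range (N + 1), ∑ w ∈ (sawWords n).filter (fun w => IsIrrBridge w),
      z ^ w.length * Real.exp (m * (xEnd w : ℝ))
          = (∑ w ∈ ((Finset.range (N + 1)).biUnion sawWords).filter (fun w => IsIrrBridge w),
          z ^ w.length * Real.exp (m * (xEnd w : ℝ))) := by
  rw [Finset.filter_biUnion, Finset.sum_biUnion]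
  intro n _ n' _ hne
  simp only [Function.onFun]
  rw [Finset.disjoint_left]
  intro w hw hw'
  exact hne ((mem_sawWords.1 (Finset.mem_filter.1 hw).1).1.symm.trans
    (mem_sawWords.1 (Finset.mem_filter.1 hw').1).1)

end KestenTilt

open KestenTilt Filter Topology in
/-- **S1 `stub_kestenTilt` (exactly tilted Kesten pairs below `x_c`).**  There is `m₀ > 0` (namely
`m₀ = 1/2`) such that for every `0 < m ≤ m₀` some `z ∈ [x_c/2, x_c]` (in fact `z < x_c`) satisfies
`Σ_{w irreducible bridge} z^{|w|} e^{m·span(w)} = 1`, as the `HasSum` over the length `n` of the finite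
sums over `(sawWords n).filter IsIrrBridge`.  Proof: `z = sup {z ∈ [x_c/2, x_c] : ∀ N, Φ_N(z, m) ≤ 1}`;
this set is closed and contains `x_c/2` (`gfIrr_half_le_one`) but not `x_c`
(`exists_gfIrr_criticalFugacity_gt`); if `sup_N Φ_N(z, m)` were `< 1`, the no-jump proposition
`exists_gt_gfIrr_bounded` and right equi-continuity (`exists_gt_forall_le`) would produce a larger
element of the set.  [cite: MadrasSlade1993, §4.2, (4.2.11)–(4.2.15)] -/
theorem stub_kestenTilt :
    ∃ m₀ : ℝ, 0 < m₀ ∧ ∀ m : ℝ, 0 < m → m ≤ m₀ →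
      ∃ z : ℝ, criticalFugacity / 2 ≤ z ∧ 0 < z ∧ z ≤ criticalFugacity ∧
        HasSum (fun n : ℕ => ∑ w ∈ (sawWords n).filter (fun w => IsIrrBridge w),
          z ^ w.length * Real.exp (m * (xEnd w : ℝ))) 1 := by
  refine ⟨1 / 2, by norm_num, fun m hm hm2 => ?_⟩
  have hxc : 0 < criticalFugacity := StripMass.criticalFugacity_pos
  set S : Set ℝ := {z | criticalFugacity / 2 ≤ z ∧ z ≤ criticalFugacity ∧ ∀ N,
      (∑ w ∈ ((Finset.range (N + 1)).biUnion sawWords).filter (fun w => IsIrrBridge w),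
      z ^ w.length * Real.exp (m * (xEnd w : ℝ))) ≤ 1}
    with hS
  have hmem : criticalFugacity / 2 ∈ S :=
    ⟨le_rfl, by linarith, fun N => gfIrr_half_le_one hm.le (exp_le_two hm2) N⟩
  have hne : S.Nonempty := ⟨_, hmem⟩
  have hbdd : BddAbove S := ⟨criticalFugacity, fun z hz => hz.2.1⟩
  have hclosed : IsClosed S := by
    have e : S = Set.Icc (criticalFugacity / 2) criticalFugacity ∩ ⋂ N,
        {z | (∑ w ∈ ((Finset.range (N + 1)).biUnion sawWords).filter (fun w => IsIrrBridge w),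
        z ^ w.length * Real.exp (m * (xEnd w : ℝ))) ≤ 1} := by
      ext z
      simp only [hS, Set.mem_setOf_eq, Set.mem_inter_iff, Set.mem_Icc, Set.mem_iInter]
      tauto
    rw [e]
    exact isClosed_Icc.inter (isClosed_iInter fun N => isClosed_le
        (continuous_gfIrr N m) continuous_const)
  set zs := sSup S with hzs
  obtain ⟨hzs1, hzs2, hzsΦ⟩ : zs ∈ S := hclosed.csSup_mem hne hbdd
  have hzs0 : 0 < zs := by linarith
  -- `x_c ∉ S`, so `zs < x_c`
  have hzslt : zs < criticalFugacity := by
    rcases hzs2.lt_or_eq with h | h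
    · exact h
    · exfalso
      obtain ⟨N, hN⟩ := exists_gfIrr_criticalFugacity_gt hm
      have := hzsΦ N
      rw [h] at this
      linarith
  -- `sup_N Φ_N(zs, m) = 1`
  have hsup : ∀ ε : ℝ, 0 < ε → ∃ N,
      1 - ε < (∑ w ∈ ((Finset.range (N + 1)).biUnion sawWords).filter (fun w => IsIrrBridge w),
      zs ^ w.length * Real.exp (m * (xEnd w : ℝ))) := by
    intro ε hε
    by_contra hcon
    push Not at hcon
    obtain ⟨z, C, hz1, -, hC⟩ := exists_gt_gfIrr_bounded hzs0 hzslt hm hε hcon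
    obtain ⟨z', hz'1, hz'2, hz'Φ⟩ :=
        exists_gt_forall_le (F := fun N z =>
        (∑ w ∈ ((Finset.range (N + 1)).biUnion sawWords).filter (fun w => IsIrrBridge w),
        z ^ w.length * Real.exp (m * (xEnd w : ℝ)))) (B := C)
      (A := 1 - ε) (κ := ε) hz1
      (fun N N' hN z hz => gfIrr_mono_N hN (hzs0.le.trans hz) m)
      (fun N N' hN z z' hz hzz' => gfIrr_sub_mono hN (hzs0.le.trans hz) hzz' m)
      (fun N => (continuous_gfIrr N m).continuousAt) hC hcon hε
    have hz'c : z' < criticalFugacity := by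
      by_contra hge
      push Not at hge
      obtain ⟨N, hN⟩ := exists_gfIrr_criticalFugacity_gt hm
      have h1 := hz'Φ N
      have h2 := gfIrr_sub_mono (Nat.zero_le N) hxc.le hge m
      have h3 : (∑ w ∈ ((Finset.range (0 + 1)).biUnion sawWords).filter (fun w => IsIrrBridge w),
          criticalFugacity ^ w.length * Real.exp (m * (xEnd w : ℝ)))
          ≤ (∑ w ∈ ((Finset.range (0 + 1)).biUnion sawWords).filter (fun w => IsIrrBridge w),
          z' ^ w.length * Real.exp (m * (xEnd w : ℝ))) :=
        Finset.sum_le_sum fun w _ => tiltWt_mono hxc.le hge m w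
      linarith
    have hz'S : z' ∈ S := ⟨by linarith, hz'c.le, fun N => by linarith [hz'Φ N]⟩
    have := le_csSup hbdd hz'S
    linarith
  -- conclusion: the partial sums increase to `1`
  refine ⟨zs, hzs1, hzs0, hzs2, ?_⟩
  rw [hasSum_iff_tendsto_nat_of_nonneg (fun n => Finset.sum_nonneg fun w _ =>
    mul_nonneg (pow_nonneg hzs0.le _) (Real.exp_nonneg _))]
  refine tendsto_atTop_isLUB (monotone_nat_of_le_succ fun N => ?_) ⟨?_, ?_⟩
  · rw [Finset.sum_range_succ]
    exact le_add_of_nonneg_right (Finset.sum_nonneg fun w _ =>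
      mul_nonneg (pow_nonneg hzs0.le _) (Real.exp_nonneg _))
  · rintro _ ⟨N, rfl⟩
    cases N with
    | zero => simp
    | succ N =>
      show ∑ n ∈ Finset.range (N + 1), _ ≤ 1
      rw [partialSum_eq]
      exact hzsΦ N
  · intro b hb
    by_contra hlt
    push Not at hlt
    obtain ⟨N, hN⟩ := hsup (1 - b) (by linarith)
    have h := hb ⟨N + 1, rfl⟩
    have h' : ∑ n ∈ Finset.range (N + 1), ∑ w ∈ (sawWords n).filter (fun w => IsIrrBridge w),
        zs ^ w.length * Real.exp (m * (xEnd w : ℝ)) ≤ b := h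
    rw [partialSum_eq] at h'
    linarith

end Summit.CriticalPhenomena.SAWScalingLimit.Theorems.TubeLowerBound.SubcriticalRenewalFloor
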